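import Summits.BirchSwinnertonDyer.BirchSwinnertonDyer.Theorems.ResidualThetaTransportAtTwoSignedMuSeedAtTwoPlusLayerDual
import Summits.BirchSwinnertonDyer.Rank1Residual.X5.KatoOrdTwoTowerGapIff
import HarnessLib

/-!
# Seed crux `SignedMuSeedAtTwoPlus` (stmt-BirchSwinnertonDyer-21438): the finite-layer `μ`-certificate in Selmer
# currency is COMPLETE — `X^ε` torsion with `μ^ε = 0` ⟺ some slack step between two residual layers of `Sel^ε_∞`

Cell `bsd-wall`, width seat `bsd-wall-rtt-p4-w3` (g3). THEOREMS ONLY (no `def`, no named fact, no `sorry`); helper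
`--supports` the seed crux; BSD is not proved by this. Route-independent imports. Sequel of `…SignedMuSeedAtTwoPlusLayerDual`
(`isTorsion_and_mu_eq_zero_of_card_fixed_lt`, the ⟸ direction) with the tree's X-side converse
`Rank1Residual.X5.TowerGap.exists_card_quotient_lt_of_finite_modP` / `finite_modP_of_isTorsion_of_mu_eq_zero` (b2b, class O1)
transported through the layer duality dictionary `natCard_quotient_layer_eq_signed`:

* `exists_card_fixed_lt_of_isTorsion_of_mu_eq_zero` — `X^ε` f.g. torsion with `μ^ε = 0` ⟹ for some `a ≤ b`,
  `#Sel^ε_∞[p,(γ−1)^b] < p^{b−a} · #Sel^ε_∞[p,(γ−1)^a]`;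
* **`isTorsion_and_mu_eq_zero_iff_exists_card_fixed_lt`** — the equivalence (line `fukuda-step`'s «the certificate is COMPLETE»,
  kernel-exact; line `layer-rank-certificate`'s S6 witness EXISTS for a clean member iff conj. 1 holds there, modulo control).

References: [Fukuda1994] Thm. 1; [Washington1997] §13.2; [GreenbergVatsal2000] Prop. (2.8); [Kobayashi2003] Thm. 1.2.
-/

set_option autoImplicit false
set_option linter.dupNamespace false

noncomputable section

open scoped Classical

open Literature.NumberTheory.EllipticCurves Literature.NumberTheory.EllipticCurves.IwasawaAlgebra
  Literature.NumberTheory.EllipticCurves.Kobayashi2003 Summit.BirchSwinnertonDyer.Rank1Residual.X5.TowerGap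

namespace Summit.BirchSwinnertonDyer.BirchSwinnertonDyer.Theorems.SignedMuAtTwo.LayerDual

universe u

variable {K : Type u} [Field K] [NumberField K] {W : WeierstrassCurve K} {p : ℕ} [Fact p.Prime]
  {κ : ZpExtension K p} {γ : Field.absoluteGaloisGroup K} {ε : ℤˣ}

/-- **Completeness of the Selmer-currency certificate.** If `X^ε(E/K_∞)` (a datum `D` at a topological generator `γ`) is
finitely generated, `Λ`-torsion and has `μ^ε = 0`, then SOME pair of layers `a ≤ b` satisfies
`#Sel^ε_∞[p,(γ−1)^b] < p^{b−a} · #Sel^ε_∞[p,(γ−1)^a]` (indeed `a = 0`, `b = #(X/pX)`: tree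
`TowerGap.exists_card_quotient_lt_of_finite_modP`, read through `natCard_quotient_layer_eq_signed`).
[cite: Washington1997, §13.2] [cite: Fukuda1994, Thm. 1] -/
theorem exists_card_fixed_lt_of_isTorsion_of_mu_eq_zero (D : SignedSelmerDualData W κ γ ε) (hγ : κ.IsTopGenerator γ)
    [Module.Finite (IwasawaAlgebra p) D.X] (hT : Module.IsTorsion (IwasawaAlgebra p) D.X) (hμ : D.mu = 0) :
    ∃ a b : ℕ, a ≤ b ∧
      Nat.card {s : signedSelmerInfty W κ ε // p • s = 0 ∧ ((conjSignedSelmerInfty W κ ε γ - 1) ^ b) s = 0} <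
        p ^ (b - a) *
          Nat.card {s : signedSelmerInfty W κ ε // p • s = 0 ∧ ((conjSignedSelmerInfty W κ ε γ - 1) ^ a) s = 0} := by
  obtain ⟨m, k, hlt⟩ := exists_card_quotient_lt_of_finite_modP p (finite_modP_of_isTorsion_of_mu_eq_zero p hT hμ)
  refine ⟨m, m + k, Nat.le_add_right m k, ?_⟩
  rw [← natCard_quotient_layer_eq_signed D hγ (m + k), ← natCard_quotient_layer_eq_signed D hγ m,
    ← towerIdeal_eq_span_pair, ← towerIdeal_eq_span_pair, show m + k - m = k by omega]
  exact hlt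

/-- **`X^ε` torsion with `μ^ε = 0` ⟺ a slack step between two residual layers of `Sel^ε(E/K_∞)`** (`E/K` elliptic over a
number field, any prime, any `ℤ_p`-extension with topological generator `γ`, any sign, any datum): the finite-layer
`μ`-certificate in Selmer currency (`isTorsion_and_mu_eq_zero_of_card_fixed_lt`) is complete. [cite: Fukuda1994, Thm. 1]
[cite: Washington1997, §13.2] [cite: GreenbergVatsal2000, Prop. (2.8)] -/
theorem isTorsion_and_mu_eq_zero_iff_exists_card_fixed_lt [W.IsElliptic] (D : SignedSelmerDualData W κ γ ε)
    (hγ : κ.IsTopGenerator γ) :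
    (Module.IsTorsion (IwasawaAlgebra p) D.X ∧ D.mu = 0) ↔
      ∃ a b : ℕ, a ≤ b ∧
        Nat.card {s : signedSelmerInfty W κ ε // p • s = 0 ∧ ((conjSignedSelmerInfty W κ ε γ - 1) ^ b) s = 0} <
          p ^ (b - a) *
            Nat.card {s : signedSelmerInfty W κ ε // p • s = 0 ∧ ((conjSignedSelmerInfty W κ ε γ - 1) ^ a) s = 0} := by
  haveI : Module.Finite (IwasawaAlgebra p) D.X := SignedSelmerDualData.moduleFinite hγ D
  exact ⟨fun h ↦ exists_card_fixed_lt_of_isTorsion_of_mu_eq_zero D hγ h.1 h.2,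
    fun ⟨_, _, hab, hlt⟩ ↦ isTorsion_and_mu_eq_zero_of_card_fixed_lt D hγ hab hlt⟩

end Summit.BirchSwinnertonDyer.BirchSwinnertonDyer.Theorems.SignedMuAtTwo.LayerDual

end
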